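import Literature.AnabelianGeometry.EtaleTheta.ArithThetaTowerCarrier
import Literature.AnabelianGeometry.EtaleTheta.ArithThetaTowerRealifiedOf
import HarnessLib

/-!
# [EtTh] Def. 3.6 (i) / Prop. 3.4 (i) for the ARITHMETIC THETA TOWER: `Φ₀` is perf-factorial (weak, cofinal) and the
# realified data `ArithThetaTower.realified d T := ofRlfZWeak (divisorMonoids d T) _` (GAP A, row D3 / item GA-03)

Mochizuki, *The étale theta function and its Frobenioid-theoretic manifestations*, Publ. RIMS **45** (2009), §3:
Prop. 3.4 (i) PDF p. 74 ("`Φ₀(Y^log)` … is perf-factorial"), Def. 3.6 (i) p. 76 ("write `Φ₀^ℝ := Φ₀^rlf` … `B₀^Λ` for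
`B₀` … if `Λ = ℤ`") [cite: MochizukiEtTh2009, Def 3.6 p.76]; Mochizuki, *Inter-universal Teichmüller theory I*,
Ex. 3.2 (i)–(iii) pp. 70–71 (the tempered Frobenioid `ℱ̲_v` at a bad place over `𝒟_v = 𝓑^temp(X̲̲_v)⁰`)
[cite: Mochizuki2012, I Ex 3.2 (ii) p.70]; *Frobenioids II*, Ex. 1.1 (i) p. 7 (`ord(𝒪^▷) ≅ ℤ≥0`)
[cite: MochizukiFrdII2008, Ex 1.1 (i) p.7].

abc-iut cell, GAP A (G-L5-EX32I-1; [IUTchI] Ex. 3.2 (i)(ii)(iii)), item **GA-03** = memo GAP-SIZING-A (69de97346848d3e8)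
§2 row D3, RULED SHAPE `plan/L5/GAP-A-SIGNATURES.md` v1 e3ccddf9b87597cf §3 VERBATIM:
`theorem ArithThetaTower.isPerfFactorial_divisorMonoids (d) (T) : <the hpf hypothesis of ofRlfZWeak at divisorMonoids d T>`
and `def ArithThetaTower.realified (d) (T) : RealifiedDivisorMonoids (D₀ := T.Dv) treeMonoidVocabWeak.{0} :=
RealifiedDivisorMonoids.ofRlfZWeak (divisorMonoids d T) (isPerfFactorial_divisorMonoids d T)` (monoid type `Λ = ℤ`,
weak data; pattern `TateTowerArithFrd` `(dm D) (hpf D)`).  INPUTS: GA-02's divisor monoid (RULINGS #334: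
`divisorMonoidsOf d T A hZ` with `Φ₀(U) = ord(𝒪^▷_{Ω^{aug U}}) × A.phiZero (P ⧸ U)`, direct sum, ★ p667325, and
`divisorMonoids d T := divisorMonoidsOf d T (deckAction d T) (Envelope.cuspLaws (Cpt d T))` at GA-10's decreed theta
envelope with the deck action of `Π`, ★ p671144 `ArithThetaTowerCarrier.lean`), and THIS SEAT's product lemma
`LogDivisorModel.GaloisAction.isPerfFactorialCof_phiZero_prod` (`ArithThetaTowerPerfFactorialProducts.lean`, p667541)
with `PadicFld.IsPadicLocal.isZMonoprime_ordInt` / `GaloisValDatum.fieldFunctor_isPadicLocal` for the constants'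
value monoid.  CONTENT: the two ruled declarations, their engine-level twins `isPerfFactorial_divisorMonoidsOf` /
`realifiedOf` (★ p668558 `ArithThetaTowerRealifiedOf.lean`, generic in the Galois-action record `A`, so that
`realified d T = realifiedOf d T (deckAction d T) _` by `rfl`).  CONTENT: the two ruled declarations, the `ℤ`-monoprime
prime components of every `Φ₀(U)` (Rmk. 3.3.1), the definitional unfoldings consumers (GA-04 / GA-12 `CarrierSpec`,
GA-07 knit) read — `toDivisorMonoids`, `Λ`, `ΦR`, `toR`, `BΛ`, `FΛ`, `divΛ`, `cnstR` — and the realified divisor of GA-02's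
theta section `thetaB₀` (`realified_divΛ_thetaB₀`: constant part trivial, geometric part `ι([cusps]/[D_1])`).

HONEST FRAMING: a construction over the tree's typed interfaces (`GaloisValDatum`, `BadLocalGroupDatum`, GA-02's
decreed finite `Ÿ_T`-avatar — FOUNDATIONS 13 for the infinite tempered tower, labelled there); "perf-factorial" READ in
the cell's weak vocabulary of record (`IsPerfFactorialCof`, F-L2d2-1/F-L2d2-2); an UNDISPUTED construction step around
[IUTchIII] Cor. 3.12, on which NO side is taken (D-0045); COUNT-NEUTRAL; typed ≠ inhabited ≠ proved-in-print; nothing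
here asserts the abc conjecture proved or refuted.
-/

noncomputable section

namespace Literature.AnabelianGeometry.EtaleTheta

open CategoryTheory Opposite Literature.AlgebraicGeometry.Frobenioids Literature.IUT.HodgeTheaters

namespace ArithThetaTower

variable {p : ℕ} [Fact p.Prime] (d : GaloisValDatum.{0} p) {P : Type} [Group P] [TopologicalSpace P]
  (T : BadLocalGroupDatum d.Gal P)

/-! ### The ruled declarations (GAP-A-SIGNATURES §3) -/

/-- **[EtTh] Prop. 3.4 (i) for the arithmetic theta tower** — the `hpf` hypothesis of
`RealifiedDivisorMonoids.ofRlfZWeak` at `divisorMonoids d T`: every `Φ₀(U)`, `U ∈ Ob(𝒟_v) = CosetCat P`, is weakly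
perf-factorial with cofinal perfection (a statement about `Φ₀` only). [cite: MochizukiEtTh2009, Prop 3.4 p.74] -/
theorem isPerfFactorial_divisorMonoids : ∀ Y : (T.Dv)ᵒᵖ, IsPerfFactorialCof ((divisorMonoids d T).Φ₀.obj Y) :=
  isPerfFactorial_divisorMonoidsOf d T (deckAction d T) (Envelope.cuspLaws (Cpt d T))

/-- **[EtTh] Def. 3.6 (i) for the arithmetic theta tower — the realified divisor data `T′` of the slot
`BadTemperedRestBirat`** (`Λ = ℤ`, weak data): `ofRlfZWeak (divisorMonoids d T) (isPerfFactorial_divisorMonoids d T)`.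
Carrier = GA-02's (c3′)-labelled divisor monoid (genuine-by-[EtTh]-recipe on the `T`-lattice + constants everywhere;
off-lattice `Φ` via `rebase`/pullback; print's `Ÿ̈`/`μ_N` Kummer levels = FOUNDATIONS 13/14, not claimed); this
declaration adds no carrier choice of its own. [cite: MochizukiEtTh2009, Def 3.6 p.76] -/
def realified : RealifiedDivisorMonoids (D₀ := T.Dv) treeMonoidVocabWeak.{0} :=
  RealifiedDivisorMonoids.ofRlfZWeak (divisorMonoids d T) (isPerfFactorial_divisorMonoids d T)

/-- `realified d T` is the engine's `realifiedOf` at the theta envelope. [cite: MochizukiEtTh2009, Def 3.6 p.76] -/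
theorem realified_eq_realifiedOf :
    realified d T = realifiedOf d T (deckAction d T) (Envelope.cuspLaws (Cpt d T)) := rfl

/-- Every prime component of `Φ₀(U)` of the arithmetic theta tower is `ℤ`-monoprime (Rmk. 3.3.1).
[cite: MochizukiEtTh2009, Rmk 3.3.1 p.73] -/
theorem isZMonoprime_submonoid_primes_divisorMonoids (Y : (T.Dv)ᵒᵖ)
    (𝔭 : Primes ((divisorMonoids d T).Φ₀.obj Y)) : IsZMonoprime ↥𝔭.submonoid :=
  isZMonoprime_submonoid_primes_divisorMonoidsOf d T (deckAction d T) (Envelope.cuspLaws (Cpt d T)) Y 𝔭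

/-- Prop. 3.4 (i), first clause, in the weak vocabulary of record (`treeMonoidVocabWeak.IsPerfFactorial =
IsPerfFactorialCof`) for the arithmetic theta tower. [cite: MochizukiEtTh2009, Prop 3.4 p.74] -/
theorem prop34_i_divisorMonoids (Y : (T.Dv)ᵒᵖ) :
    treeMonoidVocabWeak.IsPerfFactorial ((divisorMonoids d T).Φ₀.obj Y) :=
  (treeMonoidVocabWeak_isPerfFactorial _).mpr (isPerfFactorial_divisorMonoids d T Y)

/-! ### What `realified d T` returns (definitional unfoldings for GA-04 / GA-12 / GA-07) -/

/-- `realified` keeps GA-02's Def. 3.3 (iii) data. [cite: MochizukiEtTh2009, Def 3.6 p.76] -/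
@[simp] theorem realified_toDivisorMonoids : (realified d T).toDivisorMonoids = divisorMonoids d T := rfl

/-- The monoid type is `ℤ`. [cite: MochizukiEtTh2009, Def 3.6 p.76] -/
@[simp] theorem realified_Λ : (realified d T).Λ = MonoidType.Z := rfl

/-- `Φ₀^ℝ = Φ₀^rlf` (the weak realification functor of GA-02's `Φ₀`). [cite: MochizukiEtTh2009, Def 3.6 p.76] -/
theorem realified_ΦR :
    (realified d T).ΦR = rlfFunctorWeak (divisorMonoids d T).Φ₀ (isPerfFactorial_divisorMonoids d T) := rfl

/-- `Φ₀ → Φ₀^ℝ` is the natural map `Φ₀ → Φ₀^pf → Φ₀^rlf`. [cite: MochizukiEtTh2009, Def 3.6 p.76] -/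
theorem realified_toR (Y : (T.Dv)ᵒᵖ) : (realified d T).toR Y =
    ((toRlfNatTransWeak (divisorMonoids d T).Φ₀ (isPerfFactorial_divisorMonoids d T)).app Y).hom := rfl

/-- `Φ₀ → Φ₀^ℝ` on elements. [cite: MochizukiEtTh2009, Def 3.6 p.76] -/
theorem realified_toR_apply (Y : (T.Dv)ᵒᵖ) (a : (divisorMonoids d T).Φ₀.obj Y) :
    (realified d T).toR Y a =
      (isPerfFactorial_divisorMonoids d T Y).weak.toRealification (Perfection.of _ a) := rfl

/-- `B₀^ℤ = B₀` (GA-02's `(Ω^{aug U})ˣ × B₀^geom`). [cite: MochizukiEtTh2009, Def 3.6 p.76] -/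
@[simp] theorem realified_BΛ : (realified d T).BΛ = (divisorMonoids d T).B₀ := rfl

/-- `F₀^ℤ = F₀` (GA-02's constants `(Ω^{aug U})ˣ × F₀^geom`). [cite: MochizukiEtTh2009, Def 3.6 p.76] -/
@[simp] theorem realified_FΛ (Y : (T.Dv)ᵒᵖ) : (realified d T).FΛ Y = (divisorMonoids d T).F₀ Y := rfl

/-- `B₀^ℤ → (Φ₀^ℝ)^gp` is `ι^gp ∘ div₀`. [cite: MochizukiEtTh2009, Def 3.6 p.76] -/
theorem realified_divΛ_apply (Y : (T.Dv)ᵒᵖ) (b : (divisorMonoids d T).B₀.obj Y) :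
    (realified d T).divΛ Y b =
      gpMap ((toRlfNatTransWeak (divisorMonoids d T).Φ₀ (isPerfFactorial_divisorMonoids d T)).app Y).hom
        ((divisorMonoids d T).div₀ Y b) := rfl

/-- `ℝ·Φ₀^cnst` is the `ℝ`-span of `Φ₀^cnst` in `(Φ₀^rlf)^gp`. [cite: MochizukiEtTh2009, Def 3.6 p.76] -/
theorem realified_cnstR (Y : (T.Dv)ᵒᵖ) : (realified d T).cnstR Y =
    ((RealifiedDivisorMonoids.realDataWeak (divisorMonoids d T) (isPerfFactorial_divisorMonoids d T)).realSpan
      (divisorMonoids d T).cnstGp).carrier (unop Y) := rfl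

/-- Membership in the non-cuspidal part of `Φ₀^ℝ(U)`: support inside the primes arising from the non-cuspidal log-divisors
(Def. 3.6 (iii)). [cite: MochizukiEtTh2009, Def 3.6 p.77] -/
theorem mem_realified_ncspR_iff (Y : (T.Dv)ᵒᵖ) (x : (isPerfFactorial_divisorMonoids d T Y).weak.Rlf) :
    x ∈ (realified d T).ncspR Y ↔
      supp (x : RlfFactor ((divisorMonoids d T).Φ₀.obj Y)) ⊆
        RealifiedDivisorMonoids.toRSuppOfWeak (divisorMonoids d T) (isPerfFactorial_divisorMonoids d T) Y
          ((divisorMonoids d T).ncsp₀ Y) :=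
  Iff.rfl

/-- Membership in the cuspidal part of `Φ₀^ℝ(U)`: support inside the primes arising from the cuspidal log-divisors
(Def. 3.6 (iii)). [cite: MochizukiEtTh2009, Def 3.6 p.77] -/
theorem mem_realified_cspR_iff (Y : (T.Dv)ᵒᵖ) (x : (isPerfFactorial_divisorMonoids d T Y).weak.Rlf) :
    x ∈ (realified d T).cspR Y ↔
      supp (x : RlfFactor ((divisorMonoids d T).Φ₀.obj Y)) ⊆
        RealifiedDivisorMonoids.toRSuppOfWeak (divisorMonoids d T) (isPerfFactorial_divisorMonoids d T) Y
          ((divisorMonoids d T).csp₀ Y) :=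
  Iff.rfl

/-- `ℝ·Φ₀^cnst` of `realified d T` is an `ℝ`-subspace of `(Φ₀^rlf)^gp`. [cite: MochizukiEtTh2009, Def 3.6 p.76] -/
theorem realified_rsmul_mem_cnstR (Y : (T.Dv)ᵒᵖ) (s : ℝ)
    {x : Algebra.GrothendieckGroup
      ((rlfFunctorWeak (divisorMonoids d T).Φ₀ (isPerfFactorial_divisorMonoids d T)).obj Y)}
    (hx : x ∈ (realified d T).cnstR Y) :
    (RealifiedDivisorMonoids.realDataWeak (divisorMonoids d T) (isPerfFactorial_divisorMonoids d T)).rsmul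
      (unop Y) s x ∈ (realified d T).cnstR Y :=
  RealifiedDivisorMonoids.ofRlfZWeak_rsmul_mem_cnstR _ _ Y s hx

/-! ### The realified divisor of the theta section -/

/-- **The realified divisor of GA-02's theta section `θ ∈ B₀(Ÿ_T) = B₀^ℤ(Ÿ_T)`**: `divΛ θ = ι^gp (ι₂([cusps]/[D_1]))` — the
constant part of `div₀ θ` is trivial (`div₀_thetaB₀`), so only the geometric zero divisor (the cusps) over the polar divisor
(`D_1` and its translates) survives, read in `(Φ₀^rlf)^gp` (the shape S0's `CarrierSpec.theta` / a Def. 4.1 (i) fraction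
pair is evaluated in). [cite: MochizukiEtTh2009, Def 3.6 p.76] -/
theorem realified_divΛ_thetaB₀ :
    (realified d T).divΛ (op T.ydd) (thetaB₀ d T) =
      gpMap ((toRlfNatTransWeak (divisorMonoids d T).Φ₀ (isPerfFactorial_divisorMonoids d T)).app (op T.ydd)).hom
        (gpMap (MonoidHom.inr _ _)
          (Algebra.GrothendieckGroup.of (thetaZerosGeom' d T) / Algebra.GrothendieckGroup.of (thetaPolesGeom' d T))) := by
  rw [realified_divΛ_apply, div₀_thetaB₀, map_one, one_mul]
  rfl

end ArithThetaTower

end Literature.AnabelianGeometry.EtaleTheta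

end
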